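import Summits.QuantumFields.YangMills.Theorems.IRcofFluxProjectionVacuumSector
import Summits.QuantumFields.YangMills.Theorems.BalabanLadderIRcofTemporalTwistSubadditivity
import HarnessLib

/-!
# Line `flux_interlacing_v2` on crux `IRcof` ⟨stmt-QuantumFields-26930⟩ — its currency VERBATIM, and the SPECTRAL FORM of stub I
# (`SpectralFluxInterlacingEv ⇒ FluxInterlacingEv` BY NAME; helper lane, R2c cell `ym-gapexp`, director-ym R660-ym (1)(iv))

Skeleton of the line (critic `ymfull-r2c-crit-1` CUT-10: PASS, supplier ARROW #2, UNREGISTERED — the slot of record is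
`pinned_cofinal_bill.lean` d3255819134117aa): `Summits/QuantumFields/YangMills/Cruxes/IRcof/Lines/flux_interlacing_v2.lean` sha16 1bda929b912cc52d.
Its stub I = `stub_fluxInterlacingEv : FluxInterlacingEv` (LEVER ∕ SKEW ∕ IDEA-NEEDED: «a cold box whose NEUTRAL sector is ε₀-pure is
κ-interlaced», conditional confinement) is stated over objects the SKELETON defines (`IsProjDatum`, `InterlacedAt`, `FluxInterlacingEv`;
crux workfiles are not importable from `Theorems/`).

* §1 copies the four I-side currency declarations `IsProjDatum`, `InterlacedAt`, `FluxInterlacingEv`, `InterlacingSC` VERBATIM (same names,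
  bodies, binders; LINE-19 ∕ `IRcofAdaptedSpectralData.lean` precedent) into `Summit.QuantumFields.YangMills.Theorems.IRcofFluxInterlacingLine`
  (V's type `NeutralPurityCof` is NOT copied: it needs `LowerBounds`, whose module sits in a Theses cone).
* §2 types the SPECTRAL FORM of interlacing delivered by ✓`IRcofFluxProjectionVacuumSector.interlaced_of_charged_le_half_excited`:
  `SpectralInterlacedAt ρ β z n κ L` := in EVERY eigenbasis of the slice transfer operator adapted to the e-projection of `⟨z⟩³` with neutral
  vacuum `i₀` (`Z = Σ λᵢ^{m+2}`, `projZ = Σ λᵢ^{m+2} wᵢ`, `wᵢ ∈ {0,1}`, `0 ≤ λᵢ ≤ λ_{i₀}`, `0 < λ_{i₀}`, `w_{i₀} = 1`), the electric-flux weight at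
  `t = L/4` is at most `κ/2` times the excited-glue weight: `Σ λᵢ^t (1 − wᵢ) ≤ (κ/2)(Σ λᵢ^t wᵢ − λ_{i₀}^t)`; and `SpectralFluxInterlacingEv` :=
  `FluxInterlacingEv` with `InterlacedAt` replaced by `SpectralInterlacedAt`.  PROVED: ★ `interlacedAt_of_spectral`
  (`SpectralInterlacedAt → InterlacedAt`, `β ≥ 0`, `κ ≥ 0`, `8 ≤ L`) and ★★ `fluxInterlacingEv_of_spectral : SpectralFluxInterlacingEv → FluxInterlacingEv`
  — a prover of I may work in the eigenbasis: «neutral ε₀-purity ⇒ charged weight ≤ (κ/2)·excited neutral weight».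

WHAT THIS IS NOT.  Neither I nor its spectral form is proved (IDEA-NEEDED; CUT-5/10: it OWES confinement at the fixed physical scale
`ln(2d/ε₀)/m`); nothing on V (`NeutralPurityCof`), `IRcof`, `IR`, or the Yang–Mills mass gap (Clay), which is NOT proved.  Finite-volume ∕ conditional.

References: G. 't Hooft, Nucl. Phys. B 153 (1979) 141, §§4–5; K. Osterwalder, E. Seiler, Ann. Phys. 110 (1978) 440; G. Münster, Nucl. Phys. B 190
(1981) 439 (strong-coupling flux energies, for `InterlacingSC`); M. Reed, B. Simon IV (1978) Thm XIII.43–44.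
-/

set_option autoImplicit false

noncomputable section

open Filter Topology MeasureTheory
open scoped BigOperators
open Literature.MathematicalPhysics.QuantumFieldTheory
open Summit.QuantumFields.YangMills.Cruxes.IRcof.TemporalTwistSubadditivity (eTwist projZ projDefect eTwist_center)

namespace Summit.QuantumFields.YangMills.Theorems.IRcofFluxInterlacingLine

/-! ## §1 The line's I-side currency, VERBATIM from `Cruxes/IRcof/Lines/flux_interlacing_v2.lean` 1bda929b912cc52d (§0) -/

section Defs

variable {G : Type} [Group G] [TopologicalSpace G] [IsTopologicalGroup G] [CompactSpace G]
  [MeasurableSpace G] [BorelSpace G]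

/-- **Projection datum**: a central `z` of exponent `n ≥ 1` (`z ^ n = 1`). VERBATIM `FluxInterlacingV2.IsProjDatum`. -/
def IsProjDatum (z : G) (n : ℕ) : Prop :=
  z ∈ Subgroup.center G ∧ 0 < n ∧ z ^ n = 1

/-- **Interlacing of the cold box at scale `L`**: charged trace ≤ κ × excited neutral trace proxy. VERBATIM `FluxInterlacingV2.InterlacedAt`. -/
def InterlacedAt {N : ℕ} (ρ : G →* Matrix (Fin N) (Fin N) ℂ) (β : ℝ) (z : G) (n : ℕ) (κ : ℝ) (L : ℕ) : Prop :=
  wilsonFinTorusPartition ρ β L L L (L / 4) ≤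
    projZ ρ β z n L (L / 4) + κ * (projZ ρ β z n L (L / 4) - Real.sqrt (projZ ρ β z n L (2 * (L / 4))))

end Defs

/-- **I — `FluxInterlacingEv` (LEVER; skew to PXcof; IDEA-NEEDED)**: neutral purity ⇒ interlacing.
VERBATIM `FluxInterlacingV2.FluxInterlacingEv` (the TYPE of the stub `stub_fluxInterlacingEv`). -/
def FluxInterlacingEv : Prop :=
  ∀ (G : Type) [Group G] [TopologicalSpace G] [IsTopologicalGroup G] [CompactSpace G],
    IsCompactSimpleLieGroup G → SimplyConnectedSpace G →
    letI : MeasurableSpace G := borel G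
    haveI : BorelSpace G := ⟨rfl⟩
    ∀ r : LatticeRep G, ∃ κ ε₀ β₀ : ℝ, 0 ≤ κ ∧ 0 < ε₀ ∧ ∀ β : ℝ, β₀ ≤ β → ∀ L : ℕ, 8 ≤ L →
      ∀ (z : G) (n : ℕ), IsProjDatum z n → projDefect r.ρ β z n L (L / 4) ≤ ε₀ → InterlacedAt r.ρ β z n κ L

/-- **I_sc — the strong-coupling rung of the lever (ATTACKABLE leaf, cluster expansion; not used by the
composition)**: at small `β ≥ 0` every cold box is `κ`-interlaced outright, with NO purity hypothesis.
VERBATIM `FluxInterlacingV2.InterlacingSC`. -/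
def InterlacingSC : Prop :=
  ∀ (G : Type) [Group G] [TopologicalSpace G] [IsTopologicalGroup G] [CompactSpace G],
    IsCompactSimpleLieGroup G → SimplyConnectedSpace G →
    letI : MeasurableSpace G := borel G
    haveI : BorelSpace G := ⟨rfl⟩
    ∀ r : LatticeRep G, ∃ κ βs : ℝ, 0 ≤ κ ∧ 0 < βs ∧ ∀ β : ℝ, 0 ≤ β → β ≤ βs → ∀ L : ℕ, 8 ≤ L →
      ∀ (z : G) (n : ℕ), IsProjDatum z n → InterlacedAt r.ρ β z n κ L

/-! ## §2 The spectral form of interlacing and of stub I -/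

section Spectral

variable {G : Type} [Group G] [TopologicalSpace G] [IsTopologicalGroup G] [CompactSpace G]
  [MeasurableSpace G] [BorelSpace G]

/-- **Spectral interlacing of the cold box at scale `L`** (the honest target behind I): in EVERY eigenbasis of the slice transfer operator
adapted to the e-projection of `⟨z⟩³` (`Z(L³×(m+2)) = Σ λᵢ^{m+2}`, `projZ(L; m+2) = Σ λᵢ^{m+2} wᵢ`, `wᵢ ∈ {0,1}`) with NEUTRAL vacuum
`i₀` (`0 ≤ λᵢ ≤ λ_{i₀}`, `0 < λ_{i₀}`, `w_{i₀} = 1`), the ELECTRIC-FLUX weight at Euclidean time `t = L/4` is at most `κ/2` times the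
EXCITED-GLUE weight: `Σ λᵢ^t (1 − wᵢ) ≤ (κ/2) · (Σ λᵢ^t wᵢ − λ_{i₀}^t)`.  (Such bases exist: `adaptedSpectralData_projZ_vacuum`.) -/
def SpectralInterlacedAt {N : ℕ} (ρ : G →* Matrix (Fin N) (Fin N) ℂ) (β : ℝ) (z : G) (n : ℕ) (κ : ℝ) (L : ℕ) : Prop :=
  ∀ (ι : Type) (lam w : ι → ℝ) (i₀ : ι), (∀ i, 0 ≤ lam i ∧ lam i ≤ lam i₀) → 0 < lam i₀ → w i₀ = 1 →
    (∀ i, w i = 0 ∨ w i = 1) →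
    (∀ m : ℕ, HasSum (fun i => lam i ^ (m + 2)) (wilsonFinTorusPartition ρ β L L L (m + 2))) →
    (∀ m : ℕ, HasSum (fun i => lam i ^ (m + 2) * w i) (projZ ρ β z n L (m + 2))) →
      ∑' i, lam i ^ (L / 4) * (1 - w i) ≤ κ / 2 * (∑' i, lam i ^ (L / 4) * w i - lam i₀ ^ (L / 4))

/-- **I_spec — `SpectralFluxInterlacingEv`**: `FluxInterlacingEv` with its conclusion `InterlacedAt` replaced by the spectral form
`SpectralInterlacedAt` («neutral `ε₀`-purity ⇒ electric-flux weight ≤ (κ/2)·excited-glue weight at `t = L/4`»).  Implies I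
(`fluxInterlacingEv_of_spectral`).  IDEA-NEEDED exactly like I: conditional confinement. -/
def SpectralFluxInterlacingEv : Prop :=
  ∀ (G : Type) [Group G] [TopologicalSpace G] [IsTopologicalGroup G] [CompactSpace G],
    IsCompactSimpleLieGroup G → SimplyConnectedSpace G →
    letI : MeasurableSpace G := borel G
    haveI : BorelSpace G := ⟨rfl⟩
    ∀ r : LatticeRep G, ∃ κ ε₀ β₀ : ℝ, 0 ≤ κ ∧ 0 < ε₀ ∧ ∀ β : ℝ, β₀ ≤ β → ∀ L : ℕ, 8 ≤ L →
      ∀ (z : G) (n : ℕ), IsProjDatum z n → projDefect r.ρ β z n L (L / 4) ≤ ε₀ → SpectralInterlacedAt r.ρ β z n κ L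

variable [SecondCountableTopology G] {N : ℕ} {ρ : G →* Matrix (Fin N) (Fin N) ℂ}

/-- ★ **Spectral interlacing ⇒ interlacing** (`β ≥ 0`, continuous unitary `ρ`, central `z`, `0 < n`, `z ^ n = 1`, `8 ≤ L`, `0 ≤ κ`):
instantiate `SpectralInterlacedAt` at the adapted eigenbasis with neutral vacuum of
`IRcofFluxProjectionVacuumSector.interlaced_of_charged_le_half_excited`. [cite: tHooft1979Flux, §5 (5.1)–(5.4)] -/
theorem interlacedAt_of_spectral (hρ : Continuous ρ) (hρu : ∀ x, ρ x ∈ Matrix.unitaryGroup (Fin N) ℂ) {β : ℝ} (hβ : 0 ≤ β)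
    {z : G} (hz : z ∈ Subgroup.center G) {n : ℕ} (hn : 0 < n) (hzn : z ^ n = 1) {L : ℕ} (hL : 8 ≤ L) {κ : ℝ}
    (hκ : 0 ≤ κ) (h : SpectralInterlacedAt ρ β z n κ L) : InterlacedAt ρ β z n κ L := by
  obtain ⟨ι, lam, w, i₀, hlam, hL0, hw0, hw, hZ, hP, hred⟩ :=
    IRcofFluxProjectionVacuumSector.interlaced_of_charged_le_half_excited hρ hρu hβ hz hn hzn hL
  exact hred κ hκ (h ι lam w i₀ hlam hL0 hw0 hw hZ hP)

end Spectral

/-- ★★ **I_spec ⇒ I, BY NAME**: `SpectralFluxInterlacingEv → FluxInterlacingEv` (with `β₀ ↦ max β₀ 0`; second countability of `G` from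
the faithful `LatticeRep`).  A prover of the registered stub `stub_fluxInterlacingEv` may therefore work entirely in an adapted eigenbasis.
[cite: tHooft1979Flux, §5 (5.1)–(5.4)] -/
theorem fluxInterlacingEv_of_spectral (h : SpectralFluxInterlacingEv) : FluxInterlacingEv := by
  intro G _ _ _ _ hG hsc
  letI : MeasurableSpace G := borel G
  haveI : BorelSpace G := ⟨rfl⟩
  intro r
  haveI : SecondCountableTopology G :=
    (r.continuous.isClosedEmbedding r.injective).isEmbedding.secondCountableTopology
  obtain ⟨κ, ε₀, β₀, hκ, hε₀, hI⟩ := h G hG hsc r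
  refine ⟨κ, ε₀, max β₀ 0, hκ, hε₀, fun β hβ L hL z n hzn hdef => ?_⟩
  have hβ0 : 0 ≤ β := le_trans (le_max_right _ _) hβ
  have hβ₀ : β₀ ≤ β := le_trans (le_max_left _ _) hβ
  exact interlacedAt_of_spectral r.continuous r.mem_unitary hβ0 hzn.1 hzn.2.1 hzn.2.2 hL hκ
    (hI β hβ₀ L hL z n hzn hdef)

end Summit.QuantumFields.YangMills.Theorems.IRcofFluxInterlacingLine

end
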